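import Summits.NavierStokesRegularity.NavierStokesRegularity.Theses.SlicedKelvin
import Literature.Analysis.FluidPDE.AxisymmetricEuler
import HarnessLib.Audit

/-!
# Strategy census for the crux `SlicedKelvin.PlanarFluxAPriori` — typed signatures

(crux item `stmt-NavierStokesRegularity-15600`, route `route-NavierStokesRegularity-SlicedKelvin`;
strategist seat `planner-cstrat-stmt-NavierStokesRegularity-15600-0`, 2026-08-17.)

This file only TYPES the statements discussed in `STRATEGY-CENSUS.md` (one `def … : Prop` per attempt)
plus the trivial implications between them; nothing here is a new route item. Sections:

* §T Transfer — `NoSwirlCorner` (the solved sibling: axisymmetric no-swirl, Gallay–Šverák 2015 Lemma 5.1,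
  `‖ω_θ(t)‖_{L¹(Ω, dr dz)}` non-increasing = monotone meridional planar flux; ≤ 2 crossings per vortex
  circle give every other plane).
* §S Strengthen — `UniformFluxGrowth` (what the support item `FluxDataBound` collapses to under the
  Navier–Stokes scaling; uniform over ALL energies) with the trivial direction proved
  (`fluxDataBound_of_uniformFluxGrowth`) and the scaling direction stated (`FluxDataBoundCollapse`).
* §D Decomposition — the time-window split (`ShortTimeFlux`, `ReanchoredDomination`, `EpsTermVanishes`,
  `PositiveTimeFoldBudget`) lives in the separate checked skeleton `line-reanchored.lean`; here only the
  rate dichotomy piece `TypeIFluxBound` is typed, to record why it has no teeth.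
* §N Negation — `HomogeneousTailFluxDiverges`: the kinematic core of "a blow-up whose singular-time
  vorticity is asymptotically (−2)-homogeneous and not radially threaded has divergent planar flux"
  (provable now; the obstruction to the counterexample is the EXISTENCE of such a blow-up, i.e. the
  Bradshaw–Tsai wall `TypeIDSSLiouvilleConjecture` read backwards).
-/

noncomputable section

namespace Summit.NavierStokesRegularity.NavierStokesRegularity.Cruxes.PlanarFluxAPriori.Strategist

set_option linter.unusedVariables false
set_option linter.dupNamespace false

open MeasureTheory Set Filter Literature.Analysis.FluidPDE
open scoped ENNReal NNReal Topology

local notation "E3" => EuclideanSpace ℝ (Fin 3)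
local notation "E2" => EuclideanSpace ℝ (Fin 2)

/-- The unsigned planar vorticity flux of a field `v` through the plane `R{x₂ = c}` (normal `R e₂`),
verbatim the integrand of the crux. -/
def flux (v : E3 → E3) (R : E3 ≃ₗᵢ[ℝ] E3) (c : ℝ) : ℝ≥0∞ :=
  ∫⁻ y : E2, ‖inner ℝ (curl v (R (WithLp.toLp 2 ![y 0, y 1, c]))) (R (EuclideanSpace.single 2 1))‖ₑ

/-- Readback: the crux is `∀ solutions of the class, ∃ M, ∀ t < T, ∀ R c, flux (u t) R c ≤ ofReal M`. -/
example : Theses.SlicedKelvin.PlanarFluxAPriori ↔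
    ∀ (ν T : ℝ), 0 < ν → 0 < T → ∀ (u : ℝ → E3 → E3) (p : ℝ → E3 → ℝ),
      IsClassicalNSSolutionOn (Set.Ico 0 T) ν 0 u p → IsLerayHopfOn T ν 0 (u 0) u →
      HasRapidSpatialDecay (u 0) → ∃ M : ℝ, ∀ t ∈ Set.Ico 0 T, ∀ (R : E3 ≃ₗᵢ[ℝ] E3) (c : ℝ),
        flux (u t) R c ≤ ENNReal.ofReal M :=
  Iff.rfl

/-! ## §T Transfer: the axisymmetric no-swirl corner -/

/-- **§T `NoSwirlCorner` (the solved sibling's version of the crux, with the monotone constant).**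
Along a classical Leray–Hopf solution from a rapidly decaying datum whose slices are axisymmetric
without swirl, the unsigned flux through EVERY plane at every time is bounded by the initial flux
through the meridional plane `{x₁ = 0}` (frame `R₀` with normal `R₀ e₂ = e₁`): vortex lines are
circles about the axis, each crossing a plane at most twice, so `flux(P) ≤ 2‖ω_θ(t)‖_{L¹(Ω,dr dz)}`,
and `‖ω_θ(t)‖_{L¹(Ω)}` is non-increasing (Gallay–Šverák 2015, Lemma 5.1; the flux through `{x₁ = 0}`
is exactly `2‖ω_θ‖_{L¹(Ω)}`). The fold source of the route vanishes identically here (`u·n ≡ 0` on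
meridional planes) — which is the precise point where the transfer stops informing the general crux. -/
def NoSwirlCorner : Prop :=
  ∀ (ν T : ℝ), 0 < ν → 0 < T → ∀ (u : ℝ → E3 → E3) (p : ℝ → E3 → ℝ),
    IsClassicalNSSolutionOn (Set.Ico 0 T) ν 0 u p → IsLerayHopfOn T ν 0 (u 0) u →
    HasRapidSpatialDecay (u 0) → (∀ t ∈ Set.Ico 0 T, IsAxisymmetric (u t) ∧ HasNoSwirl (u t)) →
    ∀ (R₀ : E3 ≃ₗᵢ[ℝ] E3), R₀ (EuclideanSpace.single 2 1) = EuclideanSpace.single 1 1 →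
    ∀ t ∈ Set.Ico 0 T, ∀ (R : E3 ≃ₗᵢ[ℝ] E3) (c : ℝ), flux (u t) R c ≤ flux (u 0) R₀ 0

/-- The corner implies the crux restricted to no-swirl axisymmetric solutions (bookkeeping: the
initial meridional flux is finite by rapid decay — taken here as the hypothesis `hfin`, which is the
landed `stub_initialFluxFinite`). -/
theorem planarFlux_noSwirl_of_corner (hC : NoSwirlCorner)
    (hfin : ∀ (u₀ : E3 → E3), HasRapidSpatialDecay u₀ → ∃ A : NNReal, ∀ (R : E3 ≃ₗᵢ[ℝ] E3) (c : ℝ),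
      flux u₀ R c ≤ (A : ℝ≥0∞))
    (R₀ : E3 ≃ₗᵢ[ℝ] E3) (hR₀ : R₀ (EuclideanSpace.single 2 1) = EuclideanSpace.single 1 1) :
    ∀ (ν T : ℝ), 0 < ν → 0 < T → ∀ (u : ℝ → E3 → E3) (p : ℝ → E3 → ℝ),
      IsClassicalNSSolutionOn (Set.Ico 0 T) ν 0 u p → IsLerayHopfOn T ν 0 (u 0) u →
      HasRapidSpatialDecay (u 0) → (∀ t ∈ Set.Ico 0 T, IsAxisymmetric (u t) ∧ HasNoSwirl (u t)) →
      ∃ M : ℝ, ∀ t ∈ Set.Ico 0 T, ∀ (R : E3 ≃ₗᵢ[ℝ] E3) (c : ℝ), flux (u t) R c ≤ ENNReal.ofReal M := by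
  intro ν T hν hT u p hcl hLH hdec hax
  obtain ⟨A, hA⟩ := hfin (u 0) hdec
  refine ⟨(A : ℝ), fun t ht R c => ?_⟩
  rw [ENNReal.ofReal_coe_nnreal]
  exact (hC ν T hν hT u p hcl hLH hdec hax R₀ hR₀ t ht R c).trans (hA R₀ 0)

/-! ## §S Strengthen: the uniform form of `FluxDataBound` -/

/-- **§S `UniformFluxGrowth` (S⁺₁).** For every `ν > 0` and every flux level `A` there is `M` such that
EVERY solution of the class (any energy, any `‖ω₀‖_{L¹}`, any `T`) whose initial planar flux is `≤ A`
on every plane keeps planar flux `≤ M` on every plane for all `t < T`. Equivalently (scaling): the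
flux Reynolds number `Φ*/ν` can grow only by a factor controlled by its initial value,
`sup_t Φ*(t) ≤ ν·m(Φ*(0)/ν)`. On GLOBAL smooth solutions this is what the support item `FluxDataBound`
(stmt-15602) already says, because `∫|u₀|²` and `∫|curl u₀|` both scale like `λ⁻¹` under
`u ↦ λu(λx,λ²t)` while the flux is invariant and a global solution rescales to an admissible solution on
`[0,T)` for every `λ` (`FluxDataBoundCollapse` below records the formal converse as a `Prop`; over the
whole class, including hypothetical blow-up solutions whose admissible `λ` are capped, it is not claimed). -/
def UniformFluxGrowth : Prop :=
  ∀ (ν A : ℝ), 0 < ν → ∃ M : ℝ, ∀ (T : ℝ) (u : ℝ → E3 → E3) (p : ℝ → E3 → ℝ),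
    IsClassicalNSSolutionOn (Set.Ico 0 T) ν 0 u p → IsLerayHopfOn T ν 0 (u 0) u →
    HasRapidSpatialDecay (u 0) → (∀ (R : E3 ≃ₗᵢ[ℝ] E3) (c : ℝ), flux (u 0) R c ≤ ENNReal.ofReal A) →
    ∀ t ∈ Set.Ico 0 T, ∀ (R : E3 ≃ₗᵢ[ℝ] E3) (c : ℝ), flux (u t) R c ≤ ENNReal.ofReal M

/-- The trivial direction: the uniform form implies the route's `FluxDataBound` (drop the two extra
data hypotheses). -/
theorem fluxDataBound_of_uniformFluxGrowth (h : UniformFluxGrowth) :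
    Theses.SlicedKelvin.FluxDataBound := by
  intro ν T A hν hT
  obtain ⟨M, hM⟩ := h ν A hν
  exact ⟨M, fun u p hcl hLH hdec _ _ hflux t ht R c => hM T u p hcl hLH hdec hflux t ht R c⟩

/-- **`FluxDataBoundCollapse` (the scaling direction; a tightness remark for the route, not an item, and
NOT claimed over the whole class).** What IS true on paper: given a GLOBAL smooth solution `u` (all `T`)
with initial flux `≤ A`, apply `FluxDataBound (ν, T, A)` to `u_λ = λu(λx, λ²t)` on `[0, T)`; for `λ` large
its energy `λ⁻¹∫|u₀|²` and vorticity mass `λ⁻¹∫|curl u₀|` are `≤ A`, its flux at time `t` is that of `u`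
at time `λ²t`, and `u_λ` is admissible on `[0,T)` for every `λ`, so `sup_{t<∞} Φ*(u;t) ≤ M(ν,T,A)`. Hence
a family of GLOBAL flows with fixed initial flux level and unbounded flux growth refutes `FluxDataBound`.
For a solution blowing up at `T_u` the admissible `λ` are capped by `λ²T ≤ T_u`, so the implication below,
over the whole class, does not follow from scaling alone; it is recorded as a `Prop` only. Needs the
scaling covariance of `IsClassicalNSSolutionOn` / `IsLerayHopfOn` / `HasRapidSpatialDecay` (in tree for the
first: `IsClassicalNSSolutionOn.nsRescale_holds`; `IsLerayHopfOn.nsRescale` is a named `Prop`). -/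
def FluxDataBoundCollapse : Prop :=
  Theses.SlicedKelvin.FluxDataBound → UniformFluxGrowth

/-! ## §D Decomposition: the rate-dichotomy piece (recorded to show it has no teeth) -/

/-- **§D `TypeIFluxBound` (the Type-I half of the rate dichotomy).** Along every solution of the class
obeying a Type-I bound `‖u(t,x)‖ ≤ C/√(T−t)` on `[0,T)`, the planar flux stays bounded. Under the
Liouville conjecture (L) (`LiouvilleConjectureNS`, in tree) this is VACUOUSLY true (KNSS: Type-I +
(L) ⇒ no blow-up at `T` ⇒ smooth on `[0,T]` ⇒ bounded flux), so the piece is `(L)`-conditional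
bookkeeping; the complementary Type-II piece is the crux again in its wildest regime. -/
def TypeIFluxBound : Prop :=
  ∀ (ν T : ℝ), 0 < ν → 0 < T → ∀ (u : ℝ → E3 → E3) (p : ℝ → E3 → ℝ),
    IsClassicalNSSolutionOn (Set.Ico 0 T) ν 0 u p → IsLerayHopfOn T ν 0 (u 0) u →
    HasRapidSpatialDecay (u 0) →
    (∃ C : ℝ, ∀ t ∈ Set.Ico 0 T, ∀ x, ‖u t x‖ ≤ C / Real.sqrt (T - t)) →
    ∃ M : ℝ, ∀ t ∈ Set.Ico 0 T, ∀ (R : E3 ≃ₗᵢ[ℝ] E3) (c : ℝ), flux (u t) R c ≤ ENNReal.ofReal M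

/-- **§D `TypeIIFluxBound` (the complementary piece).** -/
def TypeIIFluxBound : Prop :=
  ∀ (ν T : ℝ), 0 < ν → 0 < T → ∀ (u : ℝ → E3 → E3) (p : ℝ → E3 → ℝ),
    IsClassicalNSSolutionOn (Set.Ico 0 T) ν 0 u p → IsLerayHopfOn T ν 0 (u 0) u →
    HasRapidSpatialDecay (u 0) →
    (¬ ∃ C : ℝ, ∀ t ∈ Set.Ico 0 T, ∀ x, ‖u t x‖ ≤ C / Real.sqrt (T - t)) →
    ∃ M : ℝ, ∀ t ∈ Set.Ico 0 T, ∀ (R : E3 ≃ₗᵢ[ℝ] E3) (c : ℝ), flux (u t) R c ≤ ENNReal.ofReal M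

/-- The dichotomy glue is pure logic (`em`), which is exactly why it redistributes no difficulty. -/
theorem planarFluxAPriori_of_rate_dichotomy (hI : TypeIFluxBound) (hII : TypeIIFluxBound) :
    Theses.SlicedKelvin.PlanarFluxAPriori := by
  intro ν T hν hT u p hcl hLH hdec
  by_cases h : ∃ C : ℝ, ∀ t ∈ Set.Ico 0 T, ∀ x, ‖u t x‖ ≤ C / Real.sqrt (T - t)
  · exact hI ν T hν hT u p hcl hLH hdec h
  · exact hII ν T hν hT u p hcl hLH hdec h

/-! ## §N Negation: the typed obstruction -/

/-- **§N `HomogeneousTailFluxDiverges` (kinematic core of the negation lens; provable now, size M).**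
Let `w : ℝ³ → ℝ³` be continuous off the origin and positively `(−2)`-homogeneous
(`w(λx) = λ⁻² w(x)`, `λ > 0`) — the model of the singular-time vorticity `curl u(·,T)` of a
(discretely) self-similar blow-up at the origin, `|ω(x,T)| ~ |x|⁻²`. If `w` is NOT radially threaded
on some plane through the origin, i.e. for some frame `R` (normal `n = R e₂`) the normal component
`⟪w, n⟫` does not vanish at some point of the plane `R{x₂ = 0}`, then the truncated planar flux through
that plane over the annulus `δ < |y| < 1` exceeds every bound as `δ → 0` (it equals
`log(1/δ) · ∫_{S¹} |⟪w(R(θ,0)), n⟫| dθ` by homogeneity). Consequence on paper (with regularity off the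
singular point and continuity `u(t) → u(T)` there): a first-time blow-up in the crux class that is
asymptotically `λ`-DSS with a non-radial profile violates `PlanarFluxAPriori` with `Φ* ≳ log(1/(T−t))`. -/
def HomogeneousTailFluxDiverges : Prop :=
  ∀ (w : E3 → E3), ContinuousOn w {x | x ≠ 0} →
    (∀ (s : ℝ), 0 < s → ∀ x, x ≠ 0 → w (s • x) = (s ^ 2)⁻¹ • w x) →
    ∀ (R : E3 ≃ₗᵢ[ℝ] E3), (∃ y : E2, y ≠ 0 ∧
      inner ℝ (w (R (WithLp.toLp 2 ![y 0, y 1, 0]))) (R (EuclideanSpace.single 2 1)) ≠ 0) →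
    ∀ M : ℝ, ∃ δ : ℝ, 0 < δ ∧ ENNReal.ofReal M ≤
      ∫⁻ y in {y : E2 | δ < ‖y‖ ∧ ‖y‖ < 1},
        ‖inner ℝ (w (R (WithLp.toLp 2 ![y 0, y 1, 0]))) (R (EuclideanSpace.single 2 1))‖ₑ

end Summit.NavierStokesRegularity.NavierStokesRegularity.Cruxes.PlanarFluxAPriori.Strategist

end
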